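import Literature.AlgebraicGeometry.Motives.AbelianVarietyDihedralIdempotentRelations
import HarnessLib

/-!
# Kani–Rosen's Theorem B for a finite group partitioned by a subgroup `N` of PRIME index `p` and the cyclic subgroups
# of order `p` outside it — `G = N ∪ ⋃_{n ∈ N} ⟨g₀ n⟩` (groups of Hughes–Thompson type, generalized dihedral groups,
# `A₄`, Frobenius groups `N ⋊ C_p`): `X^{|N|} × B_G^{p|N|} ∼ B_N^{|N|} × ∏_{n ∈ N} B_{⟨g₀n⟩}^p` — ALGEBRAIC carrier

Layer A1/A2 of the Hodge foundations lane (`lit-hodgefound`, row A1-20⁺ · A2, seat p03 generation 24, row g24-#4)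
on the ALGEBRAIC carrier `AbelianVariety K` of `Motives/AbelianVariety` — Hom counts over an ARBITRARY field,
isogenies and dimensions over a PERFECT field.  Sequel of `Motives/AbelianVarietyIdempotentRelations` §4 (Theorem B:
`sum_card_mul_finrank_hom_image_norm_eq_of_partition` — CONSUMED) and companion of
`Motives/AbelianVarietyDihedralIdempotentRelations` (the case `p = 2`: a subgroup `A` of index `2` all of whose outside
elements are involutions is exactly a generalized dihedral pair, `τaτ⁻¹ = a⁻¹`; its `sum_finrank_hom_image_dihedral_eq`
is the `p = 2` instance of this file's Hom count, proved there from the inversion hypothesis — not restated, not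
re-derived), of `Motives/AbelianVarietyTetrahedralIdempotentRelations` (`A₄ ⊃ V₄`, `p = 3`) and of
`Motives/AbelianVarietyFrobeniusGroupIdempotentRelations` (Frobenius groups `N ⋊ H`; here `H ≅ C_p`).  The group theory
of §1 is ABSTRACT (any finite group; no `decide`).  Everything is PROVED; the file introduces NO definition and NO named
fact (net Literature debt 0).

## Sources, verbatim

M. Garonzi, M. L. Dias, *Group partitions of minimal size*, J. Algebra **531** (2019) 1–18 (arXiv 1811.02996, held
text `paper:arxiv-1811.02996`), §2 p0004: "**Lemma 2.** Let `𝒫 = {H_1, …, H_m}` be a partition of the group `G`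
consisting of nontrivial subgroups. Then `|𝒫| ≥ 1 + |H_i|` for any `i = 1, …, m`, and if `H_i` is normal in `G` and
`|G : H_i|` is a prime then `|𝒫| = 1 + |H_i|`. Proof. Fix `i ∈ {1, …, m}`. Let `j ∈ {1, …, m}` with `j ≠ i`. Since
`H_i ∩ H_j = {1}` we have `|G| ≥ |H_i H_j| = |H_i| |H_j|` thus `|H_j| ≤ |G : H_i|` […] if `|G : H_i|` is a prime then
`|H_j| = |G : H_i|` whenever `j ≠ i`"; §6 p0009: "A group of Hughes-Thompson type relative to the prime `p` is a group
`G` such that `G` is not a `p`-group and the subgroup generated by the elements of order different from `p`,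
`H_p(G) = ⟨x ∈ G : x^p ≠ 1⟩`, is not equal to `G`. For such a group `|G : H_p(G)| = p` and `H_p(G)` is a normal
nilpotent subgroup of `G` (see [bryce]). Observe that the class of groups of Hughes-Thompson type is not contained in
the class of Frobenius groups, consider as an example the dihedral group of order `12`. **Proposition 6.** Let `G` be
a group of Hughes-Thompson type relative to the prime `p`. Then we have the following. If `G` is not a Frobenius group
then `H = H_p(G)` is a member of every partition of `G` and `ρ(G) = |H| + 1`."

G. Korchmáros, S. Lia, M. Timpanella, *A generalization of Bring's curve in any characteristic* (2021), arXiv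
2112.10886, §10 p. 27: "**Theorem 10.1** (Kani–Rosen). Let `G` be a finite automorphism group of an algebraic curve
`𝒳`. If `G` is equipped by a partition, then the following isogeny relation holds: (32)
`J^{t−1}_𝒳 × J^{|G|}_{𝒳/G} ∼ J^{h_1}_{𝒳/H_1} × ⋯ × J^{h_t}_{𝒳/H_t}`, where `H_1, …, H_t` are the components of the
partition and `h_i = |H_i|`".  S. Reyes-Carocca, *On pq-fold regular covers of the projective line*, RACSAM 115 (2021),
arXiv 2006.15499, Thm. 7 (`C_q ⋊ C_p`): "`JS ∼ JX × JY^p`" (quoted in `…FrobeniusGroupIdempotentRelations`).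

## Dictionary and what is proved (namespace `Literature.AlgebraicGeometry.Motives.AbelianVariety`)

`G` a finite group, `N ≤ G` a subgroup with `|G| = p · |N|` (`p` prime — so `[G : N] = p`; `N` need NOT be normal),
such that **every element outside `N` satisfies `g ^ p = 1`** (`hout`; equivalently has order `p`,
`orderOf_eq_of_forall_not_mem_pow_eq_one`), and a fixed `g₀ ∉ N`.  Examples: `N = H_p(G)` of a group of Hughes–Thompson
type; `N = A` of a generalized dihedral group `A ⋊ ⟨τ⟩` (`p = 2`); `N = V₄ ◁ A₄` (`p = 3`); the kernel of a Frobenius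
group with complement `C_p`.  An action `ρ : G →* End X` on an abelian variety; `B_N = Im N_N` (`End.of N_N = Σ_{h : N}
ρ h`), `B_G = Im N_G`, and for the components outside `N` the EXPLICIT norm endomorphisms
`B_{⟨g₀n⟩} = Im(Σ_{k < p} ρ((g₀ n)ᵏ))` (`of_asHom_sum_range_eq_sum_zpowers`: `= Σ_{h ∈ ⟨g₀n⟩} ρ h`).

* §1 (group theory, any finite `G`): `eq_one_of_mem_zpowers_of_mem` (`⟨g⟩ ∩ N = 1` for `g ∉ N`),
  `injective_quotient_mk_zpowers` (`⟨g⟩ ↪ G/N`), **`exists_mem_zpowers_mul`** (COVER: every `g ∉ N` lies in some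
  `⟨g₀ n⟩`, `n ∈ N` — `⟨g⟩` is a transversal of `N`), **`eq_of_mem_zpowers_mul`** (distinct `n` give components meeting
  only in `1`): `G = N ∪ ⋃_{n ∈ N} ⟨g₀ n⟩` is a partition with `t = |N| + 1` components ("`|𝒫| = 1 + |H_i|`").
* §2 (any field) **`sum_finrank_hom_image_primeIndex_eq`**: for every `B`,
  `|N| rk Hom(B_N, B) + p Σ_{n ∈ N} rk Hom(B_{⟨g₀n⟩}, B) = |N| rk Hom(X, B) + p|N| rk Hom(B_G, B)` (Theorem B's
  `χ_B`-count for this partition, on the index set `Option N`); `finrank_hom_primeIndex_of_forall_eq` (if all the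
  `B_{⟨g₀n⟩}` have the Hom counts of one `Y` — e.g. all conjugate to `⟨g₀⟩`, by `finrank_hom_image_norm_eq_of_conj` —
  then `rk Hom(B_N, B) + p rk Hom(Y, B) = rk Hom(X, B) + p rk Hom(B_G, B)`).
* §3 (perfect field) **`isIsogenous_kaniRosenB_primeIndex`**: `X^{|N|} × B_G^{p|N|} ∼ B_N^{|N|} × ∏_{n ∈ N} B_{⟨g₀n⟩}^p`;
  `dim_primeIndex`; **`isIsogenous_primeIndex_of_forall_eq`**: `X × B_G^p ∼ B_N × Y^p` in the collapsed case
  ("`JS ∼ JX × JY^p`").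

Scope (stated, not hidden). (1) The conjugacy classes of the components `⟨g₀ n⟩` (the `N`-orbits on the coset `g₀N`)
are not determined in general — the relation is stated component-wise over `n ∈ N`; the collapsed form takes the
equality of Hom counts as a hypothesis (`heq`).  (2) That `H_p(G)` has index `p` in a group of Hughes–Thompson type
(Hughes–Thompson–Kegel) is NOT proved here: the index-`p` subgroup `N` and the exponent condition outside it are the
hypotheses.  (3) As in all predecessors `J_{X/H}` is replaced by `ε_H(X) = Im N_H`; Hom counts over any field,
isogenies over a perfect field.

## References

* [GaronziDias2019] M. Garonzi, M. L. Dias, *Group partitions of minimal size*, J. Algebra 531 (2019) 1–18,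
  arXiv:1811.02996, §2 Lemma 2, §5 (Frobenius groups), §6 Prop. 6 (groups of Hughes–Thompson type).
* [KaniRosen1989] E. Kani, M. Rosen, *Idempotent relations and factors of Jacobians*, Math. Ann. 284 (1989) 307–327,
  Thm. B.
* [KorchmarosLiaTimpanella2021] G. Korchmáros, S. Lia, M. Timpanella, arXiv:2112.10886 (2021), §10 Thm. 10.1 (32).
* [ReyesCarocca2020] S. Reyes-Carocca, *On pq-fold regular covers of the projective line*, RACSAM 115 (2021),
  arXiv:2006.15499, Thm. 7.
* [Paulhus2008] J. Paulhus, Acta Arith. 132 (2008) 231–244, §2 (`ε_H = |H|⁻¹ Σ_{h ∈ H} h`, p. 232).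
-/

noncomputable section

universe u

open CategoryTheory CategoryTheory.Limits

namespace Literature.AlgebraicGeometry.Motives

namespace AbelianVariety

variable {K : Type u} [Field K]

/-! ## §1 Group theory: a subgroup `N` of prime index `p` all of whose outside elements have order `p` gives the
partition `G = N ∪ ⋃_{n ∈ N} ⟨g₀ n⟩` -/

section PrimeIndexGroup

variable {G : Type} [Group G] [Finite G] {N : Subgroup G} {p : ℕ}

omit [Finite G] in
/-- An element outside `N` has order exactly `p` (it is `≠ 1` since `1 ∈ N`, and `g ^ p = 1`).
[cite: GaronziDias2019, §6 ("H_p(G) = ⟨x ∈ G : x^p ≠ 1⟩ is not equal to G")] -/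
theorem orderOf_eq_of_forall_not_mem_pow_eq_one (hp : p.Prime) (hout : ∀ g : G, g ∉ N → g ^ p = 1) {g : G}
    (hg : g ∉ N) : orderOf g = p := by
  haveI := Fact.mk hp
  exact orderOf_eq_prime (hout g hg) fun h1 ↦ hg (h1 ▸ N.one_mem)

/-- In a cyclic group `⟨g⟩` of prime order every `c ≠ 1` is a generator: `⟨c⟩ = ⟨g⟩`. [folklore] -/
private theorem zpowers_eq_zpowers_of_mem (hp : p.Prime) {g c : G} (hg : orderOf g = p)
    (hc : c ∈ Subgroup.zpowers g) (hc1 : c ≠ 1) : Subgroup.zpowers c = Subgroup.zpowers g := by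
  obtain ⟨k, rfl⟩ := Subgroup.mem_zpowers_iff.1 hc
  have h1 : (g ^ k) ^ p = 1 := by
    rw [← zpow_natCast, ← zpow_mul, mul_comm, zpow_mul, zpow_natCast, ← hg, pow_orderOf_eq_one, one_zpow]
  have hcp : orderOf (g ^ k) = p :=
    (hp.eq_one_or_self_of_dvd _ (orderOf_dvd_of_pow_eq_one h1)).resolve_left
      fun h ↦ hc1 (orderOf_eq_one_iff.1 h)
  refine Subgroup.eq_of_le_of_card_ge (Subgroup.zpowers_le.2 hc) ?_
  rw [Nat.card_zpowers, Nat.card_zpowers, hg, hcp]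

/-- **`⟨g⟩ ∩ N = 1` for `g ∉ N`**: a non-trivial element of `⟨g⟩` generates `⟨g⟩`, so it cannot lie in `N`.
[cite: GaronziDias2019, §2 Lemma 2 and §6 Prop. 6] -/
theorem eq_one_of_mem_zpowers_of_mem (hp : p.Prime) (hout : ∀ g : G, g ∉ N → g ^ p = 1) {g : G} (hg : g ∉ N)
    {x : G} (hx : x ∈ Subgroup.zpowers g) (hxN : x ∈ N) : x = 1 := by
  by_contra hx1
  have h := zpowers_eq_zpowers_of_mem hp (orderOf_eq_of_forall_not_mem_pow_eq_one hp hout hg) hx hx1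
  have hle : Subgroup.zpowers g ≤ N := by
    rw [← h]
    exact Subgroup.zpowers_le.2 hxN
  exact hg (Subgroup.zpowers_le.1 hle)

/-- The cyclic subgroup `⟨g⟩` of an outside element maps injectively to the coset space `G/N` (`⟨g⟩ ∩ N = 1`).
[cite: GaronziDias2019, §2 Lemma 2 (proof: "|G| ≥ |H_i H_j| = |H_i| |H_j|")] -/
theorem injective_quotient_mk_zpowers (hp : p.Prime) (hout : ∀ g : G, g ∉ N → g ^ p = 1) {g : G} (hg : g ∉ N) :
    Function.Injective fun c : Subgroup.zpowers g ↦ ((c : G) : G ⧸ N) := by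
  intro c d hcd
  have h1 : (c : G)⁻¹ * d ∈ N := QuotientGroup.eq.1 hcd
  have h2 : (c : G)⁻¹ * d ∈ Subgroup.zpowers g := mul_mem (inv_mem c.2) d.2
  exact Subtype.ext (inv_mul_eq_one.1 (eq_one_of_mem_zpowers_of_mem hp hout hg h2 h1))

/-- **Cover**: if `|G| = p |N|` then every `g ∉ N` lies in `⟨g₀ n⟩` for some `n ∈ N` (`⟨g⟩` has `p = [G : N]` elements in
distinct cosets, so it meets the coset `g₀ N` in a generator `g₀ n` of `⟨g⟩`).
[cite: GaronziDias2019, §2 Lemma 2 ("if H_i is normal in G and |G:H_i| is a prime then |𝒫| = 1 + |H_i|") and §6] -/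
theorem exists_mem_zpowers_mul (hp : p.Prime) (hG : Nat.card G = p * Nat.card N)
    (hout : ∀ g : G, g ∉ N → g ^ p = 1) {g₀ : G} (hg₀ : g₀ ∉ N) {g : G} (hg : g ∉ N) :
    ∃ n : N, g ∈ Subgroup.zpowers (g₀ * n) := by
  have hgp := orderOf_eq_of_forall_not_mem_pow_eq_one hp hout hg
  have hidx : Nat.card (G ⧸ N) = p := by
    rw [← Subgroup.index_eq_card]
    have h := N.index_mul_card
    rw [hG] at h
    exact Nat.eq_of_mul_eq_mul_right Nat.card_pos h
  have hbij := (injective_quotient_mk_zpowers hp hout hg).bijective_of_nat_card_le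
    (by rw [hidx, Nat.card_zpowers, hgp])
  obtain ⟨c, hc⟩ := hbij.2 ((g₀ : G) : G ⧸ N)
  have hcg : (c : G)⁻¹ * g₀ ∈ N := QuotientGroup.eq.1 hc
  have hc1 : (c : G) ≠ 1 := fun h1 ↦ hg₀ (by simpa [h1] using hcg)
  refine ⟨⟨((c : G)⁻¹ * g₀)⁻¹, inv_mem hcg⟩, ?_⟩
  have hc' : g₀ * ((c : G)⁻¹ * g₀)⁻¹ = c := by group
  rw [hc', zpowers_eq_zpowers_of_mem hp hgp c.2 hc1]
  exact Subgroup.mem_zpowers g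

/-- **Distinct `n ∈ N` give distinct components**: if `⟨g₀ n⟩` and `⟨g₀ m⟩` share a non-trivial element then `n = m`
(both `g₀ n`, `g₀ m` then generate the same cyclic group and lie in the same coset `g₀ N`).
[cite: GaronziDias2019, §2 Lemma 2 and §6] -/
theorem eq_of_mem_zpowers_mul (hp : p.Prime) (hout : ∀ g : G, g ∉ N → g ^ p = 1) {g₀ : G} (hg₀ : g₀ ∉ N)
    {n m : N} {x : G} (hx1 : x ≠ 1) (hn : x ∈ Subgroup.zpowers (g₀ * n)) (hm : x ∈ Subgroup.zpowers (g₀ * m)) :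
    n = m := by
  have hgn : ∀ k : N, g₀ * k ∉ N := fun k h ↦ hg₀ (by simpa using N.mul_mem h (N.inv_mem k.2))
  have hxn := zpowers_eq_zpowers_of_mem hp (orderOf_eq_of_forall_not_mem_pow_eq_one hp hout (hgn n)) hn hx1
  have hxm := zpowers_eq_zpowers_of_mem hp (orderOf_eq_of_forall_not_mem_pow_eq_one hp hout (hgn m)) hm hx1
  have hmem : g₀ * m ∈ Subgroup.zpowers (g₀ * n) := by
    rw [← hxn, hxm]
    exact Subgroup.mem_zpowers _
  have hcoset : ((g₀ * n : G) : G ⧸ N) = ((g₀ * m : G) : G ⧸ N) :=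
    QuotientGroup.eq.2 (by simpa [mul_assoc] using N.mul_mem (N.inv_mem n.2) m.2)
  have h := injective_quotient_mk_zpowers hp hout (hgn n)
    (a₁ := ⟨g₀ * n, Subgroup.mem_zpowers _⟩) (a₂ := ⟨g₀ * m, hmem⟩) hcoset
  exact Subtype.ext (mul_left_cancel (congrArg Subtype.val h))

end PrimeIndexGroup

/-! ## §2 The Hom counts of Theorem B for `G = N ∪ ⋃_{n ∈ N} ⟨g₀ n⟩` (any field) -/

section PrimeIndex

variable {X : AbelianVariety K} {G : Type} [Group G] (ρ : G →* End X)

/-- `Σ_{y ∈ ⟨x⟩} f(y) = Σ_{i < |x|} f(xⁱ)` (any `Fintype` structure on `⟨x⟩`). [folklore] -/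
private theorem sum_zpowers_eq_sum_range {M : Type*} [AddCommMonoid M] {x : G} [Fintype (Subgroup.zpowers x)]
    (hx : IsOfFinOrder x) (f : G → M) :
    ∑ y : Subgroup.zpowers x, f y = ∑ i ∈ Finset.range (orderOf x), f (x ^ i) := by
  rw [← Fin.sum_univ_eq_sum_range (fun i ↦ f (x ^ i)) (orderOf x)]
  exact (Fintype.sum_equiv (finEquivZPowers hx) (fun i ↦ f (x ^ (i : ℕ))) (fun y ↦ f y)
    (fun i ↦ by rw [finEquivZPowers_apply])).symm

/-- **The norm endomorphism of a cyclic subgroup of order `p`: `N_⟨g⟩ = Σ_{k < p} ρ(gᵏ)`** (any `Fintype` structure on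
`⟨g⟩`). [cite: Paulhus2008, §2 ("ε_H = |H|⁻¹ Σ_{h ∈ H} h", p. 232)] [cite: KaniRosen1989, Thm. B] -/
theorem of_asHom_sum_range_eq_sum_zpowers [Finite G] {g : G} {p : ℕ} [Fintype (Subgroup.zpowers g)]
    (hg : orderOf g = p) :
    End.of (End.asHom (∑ k ∈ Finset.range p, ρ (g ^ k))) = ∑ h : Subgroup.zpowers g, ρ h := by
  rw [sum_zpowers_eq_sum_range (isOfFinOrder_of_finite g) (fun y ↦ ρ y), hg]

variable [Fintype G] {N : Subgroup G} [Fintype N] {p : ℕ} {g₀ : G} {NG NN : X ⟶ X}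

/-- **Kani–Rosen Theorem B for a group partitioned by a subgroup of prime index and the cyclic subgroups outside it —
the Hom counts (any field).**  Let `N ≤ G` with `|G| = p |N|`, `p` prime, such that every element outside `N` has
order `p` (`g ^ p = 1` for `g ∉ N`: the groups of Hughes–Thompson type with `N = H_p(G)`; the generalized dihedral groups,
`p = 2`; `A₄ ⊃ V₄`, `p = 3`; the Frobenius groups `N ⋊ C_p`), and fix `g₀ ∉ N`.  Then `G = N ∪ ⋃_{n ∈ N} ⟨g₀ n⟩` is a
partition into `t = |N| + 1` subgroups ("if `H_i` is normal in `G` and `|G : H_i|` is a prime then `|𝒫| = 1 + |H_i|`"),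
and Theorem B's Hom counts `Σ_i |H_i| rk Hom(B_{H_i}, B) = (t − 1) rk Hom(X, B) + |G| rk Hom(B_G, B)` read, for every
`B`: **`|N| · rk Hom(B_N, B) + p · Σ_{n ∈ N} rk Hom(B_{⟨g₀n⟩}, B) = |N| · rk Hom(X, B) + p |N| · rk Hom(B_G, B)`**, with
`B_N = Im N_N`, `B_G = Im N_G`, `B_{⟨g₀n⟩} = Im(Σ_{k<p} ρ((g₀n)ᵏ))`.
[cite: KaniRosen1989, Thm. B] [cite: KorchmarosLiaTimpanella2021, §10 Thm. 10.1 (32)]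
[cite: GaronziDias2019, §2 Lemma 2 and §6 (groups of Hughes–Thompson type)] -/
theorem sum_finrank_hom_image_primeIndex_eq (hp : p.Prime) (hG : Fintype.card G = p * Fintype.card N)
    (hout : ∀ g : G, g ∉ N → g ^ p = 1) (hg₀ : g₀ ∉ N) (hNG : End.of NG = ∑ g, ρ g)
    (hNN : End.of NN = ∑ h : N, ρ h) (B : AbelianVariety K) :
    Fintype.card N * Module.finrank ℤ (image NN ⟶ B) +
        p * ∑ n : N, Module.finrank ℤ (image (End.asHom (∑ k ∈ Finset.range p, ρ ((g₀ * n) ^ k))) ⟶ B) =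
      Fintype.card N * Module.finrank ℤ (X ⟶ B) + p * Fintype.card N * Module.finrank ℤ (image NG ⟶ B) := by
  classical
  let H : Option N → Subgroup G := fun o ↦ o.elim N fun n ↦ Subgroup.zpowers (g₀ * (n : G))
  letI instH : ∀ i, Fintype (H i) := fun i ↦
    match i with
    | none => ‹Fintype N›
    | some _ => Fintype.ofFinite _
  let Nf : Option N → (X ⟶ X) := fun o ↦
    o.elim NN fun n ↦ End.asHom (∑ k ∈ Finset.range p, ρ ((g₀ * (n : G)) ^ k))
  have hG' : Nat.card G = p * Nat.card N := by
    rwa [Nat.card_eq_fintype_card, Nat.card_eq_fintype_card]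
  have hgn : ∀ n : N, g₀ * n ∉ N := fun n h ↦ hg₀ (by simpa using N.mul_mem h (N.inv_mem n.2))
  have hcover : ∀ g : G, ∃ i, g ∈ H i := fun g ↦ by
    by_cases hg : g ∈ N
    · exact ⟨none, hg⟩
    · obtain ⟨n, hn⟩ := exists_mem_zpowers_mul hp hG' hout hg₀ hg
      exact ⟨some n, hn⟩
  have hdisj : ∀ i j, i ≠ j → ∀ g : G, g ∈ H i → g ∈ H j → g = 1 := by
    rintro (_ | n) (_ | m) hij g hgi hgj
    · exact absurd rfl hij
    · exact eq_one_of_mem_zpowers_of_mem hp hout (hgn m) hgj hgi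
    · exact eq_one_of_mem_zpowers_of_mem hp hout (hgn n) hgi hgj
    · by_contra hg1
      exact hij (congrArg some (eq_of_mem_zpowers_mul hp hout hg₀ hg1 hgi hgj))
  have hNf : ∀ i, End.of (Nf i) = ∑ h : H i, ρ h := by
    rintro (_ | n)
    · exact hNN
    · exact @of_asHom_sum_range_eq_sum_zpowers K _ X G _ ρ _ (g₀ * (n : G)) p (instH (some n))
        (orderOf_eq_of_forall_not_mem_pow_eq_one hp hout (hgn n))
  have key := sum_card_mul_finrank_hom_image_norm_eq_of_partition H ρ hcover hdisj hNf hNG B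
  have hcS : Fintype.card (H none) = Fintype.card N := rfl
  have hcR : ∀ n : N, Fintype.card (H (some n)) = p := fun n ↦ by
    rw [← Nat.card_eq_fintype_card]
    exact (Nat.card_zpowers _).trans (orderOf_eq_of_forall_not_mem_pow_eq_one hp hout (hgn n))
  have hcO : Fintype.card (Option N) - 1 = Fintype.card N := by rw [Fintype.card_option, Nat.add_sub_cancel]
  rw [Fintype.sum_option, hcS, hcO, hG] at key
  simp only [hcR, Nf, Option.elim_none, Option.elim_some] at key
  rw [← Finset.mul_sum] at key
  exact_mod_cast key

/-- **The class-collapsed Hom counts**: if moreover all the components outside `N` have the Hom counts of `B_{⟨g₀⟩}`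
(e.g. they are all conjugate — Frobenius groups `N ⋊ ⟨g₀⟩`, or `A₄` — by `finrank_hom_image_norm_eq_of_conj`), then
for every `B`: **`rk Hom(B_N, B) + p · rk Hom(B_{⟨g₀⟩}, B) = rk Hom(X, B) + p · rk Hom(B_G, B)`**
("`X × B_G^{|H|} ∼ B_N × B_H^{|H|}`" for `H = ⟨g₀⟩ ≅ C_p`). [cite: KaniRosen1989, Thm. B]
[cite: ReyesCarocca2020, Thm. 7 ("JS ∼ JX × JY^p")] [cite: GaronziDias2019, §5 and §6] -/
theorem finrank_hom_primeIndex_of_forall_eq (hp : p.Prime) (hG : Fintype.card G = p * Fintype.card N)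
    (hout : ∀ g : G, g ∉ N → g ^ p = 1) (hg₀ : g₀ ∉ N) (hNG : End.of NG = ∑ g, ρ g)
    (hNN : End.of NN = ∑ h : N, ρ h) {Y : AbelianVariety K} (B : AbelianVariety K)
    (heq : ∀ n : N, Module.finrank ℤ (image (End.asHom (∑ k ∈ Finset.range p, ρ ((g₀ * n) ^ k))) ⟶ B) =
      Module.finrank ℤ (Y ⟶ B)) :
    Module.finrank ℤ (image NN ⟶ B) + p * Module.finrank ℤ (Y ⟶ B) =
      Module.finrank ℤ (X ⟶ B) + p * Module.finrank ℤ (image NG ⟶ B) := by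
  have h := sum_finrank_hom_image_primeIndex_eq ρ hp hG hout hg₀ hNG hNN B
  rw [Finset.sum_congr rfl fun n _ ↦ heq n, Finset.sum_const, Finset.card_univ, smul_eq_mul] at h
  refine Nat.eq_of_mul_eq_mul_left (Fintype.card_pos (α := N)) ?_
  calc Fintype.card N * (Module.finrank ℤ (image NN ⟶ B) + p * Module.finrank ℤ (Y ⟶ B))
      = Fintype.card N * Module.finrank ℤ (image NN ⟶ B) +
          p * (Fintype.card N * Module.finrank ℤ (Y ⟶ B)) := by ring
    _ = Fintype.card N * Module.finrank ℤ (X ⟶ B) + p * Fintype.card N * Module.finrank ℤ (image NG ⟶ B) := h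
    _ = Fintype.card N * (Module.finrank ℤ (X ⟶ B) + p * Module.finrank ℤ (image NG ⟶ B)) := by ring

end PrimeIndex

/-! ## §3 The isogenies over a perfect field: `X^{|N|} × B_G^{p|N|} ∼ B_N^{|N|} × ∏_{n ∈ N} B_{⟨g₀n⟩}^p` -/

section PrimeIndexIsogeny

variable [PerfectField K] {X : AbelianVariety K} {G : Type} [Group G] [Fintype G] (ρ : G →* End X)
  {N : Subgroup G} [Fintype N] {p : ℕ} {g₀ : G} {NG NN : X ⟶ X}

/-- **Kani–Rosen Theorem B for `G = N ∪ ⋃_{n ∈ N} ⟨g₀ n⟩`** (`N` of prime index `p`, all outside elements of order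
`p`; perfect field): **`X^{|N|} × B_G^{p|N|} ∼ B_N^{|N|} × ∏_{n ∈ N} B_{⟨g₀n⟩}^p`**
("`J^{t−1}_𝒳 × J^{|G|}_{𝒳/G} ∼ J^{h_1}_{𝒳/H_1} × ⋯ × J^{h_t}_{𝒳/H_t}`" with `t − 1 = |N|`, `|G| = p|N|`, `h = |N|, p, …, p`).
[cite: KaniRosen1989, Thm. B] [cite: KorchmarosLiaTimpanella2021, §10 Thm. 10.1 (32)] [cite: GaronziDias2019, §2 Lemma 2 and §6] -/
theorem isIsogenous_kaniRosenB_primeIndex (hp : p.Prime) (hG : Fintype.card G = p * Fintype.card N)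
    (hout : ∀ g : G, g ∉ N → g ^ p = 1) (hg₀ : g₀ ∉ N) (hNG : End.of NG = ∑ g, ρ g)
    (hNN : End.of NN = ∑ h : N, ρ h) :
    IsIsogenous ((⨁ fun _ : Fin (Fintype.card N) ↦ X) ⊞ ⨁ fun _ : Fin (p * Fintype.card N) ↦ image NG)
      ((⨁ fun _ : Fin (Fintype.card N) ↦ image NN) ⊞
        ⨁ fun n : N ↦ ⨁ fun _ : Fin p ↦ image (End.asHom (∑ k ∈ Finset.range p, ρ ((g₀ * n) ^ k)))) := by
  classical
  refine isIsogenous_iff_forall_finrank_hom_eq'.2 fun B ↦ ?_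
  rw [finrank_hom_biprod, finrank_hom_biproduct_const, finrank_hom_biproduct_const, finrank_hom_biprod,
    finrank_hom_biproduct_const, finrank_hom_biproduct]
  simp only [finrank_hom_biproduct_const, Fintype.card_fin]
  have h := sum_finrank_hom_image_primeIndex_eq ρ hp hG hout hg₀ hNG hNN B
  rw [Finset.mul_sum] at h
  rw [← h]

/-- **Dimensions** ("`|N| · dim X + p|N| · dim B_G = |N| · dim B_N + p · Σ_{n ∈ N} dim B_{⟨g₀n⟩}`", the abelian-variety
form of the Riemann–Hurwitz count for such covers; perfect field). [cite: KaniRosen1989, Thm. B]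
[cite: KorchmarosLiaTimpanella2021, §10 Thm. 10.1 (32)] -/
theorem dim_primeIndex (hp : p.Prime) (hG : Fintype.card G = p * Fintype.card N)
    (hout : ∀ g : G, g ∉ N → g ^ p = 1) (hg₀ : g₀ ∉ N) (hNG : End.of NG = ∑ g, ρ g)
    (hNN : End.of NN = ∑ h : N, ρ h) :
    Fintype.card N * X.dim + p * Fintype.card N * (image NG).dim =
      Fintype.card N * (image NN).dim +
        p * ∑ n : N, (image (End.asHom (∑ k ∈ Finset.range p, ρ ((g₀ * n) ^ k)))).dim := by
  classical
  have h := (isIsogenous_kaniRosenB_primeIndex ρ hp hG hout hg₀ hNG hNN).dim_eq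
  rw [dim_biprod, dim_biproduct_const, dim_biproduct_const, dim_biprod, dim_biproduct_const, dim_biproduct] at h
  simp only [dim_biproduct_const, Fintype.card_fin] at h
  rw [h, Finset.mul_sum]

/-- **The class-collapsed isogeny `X × B_G^p ∼ B_N × B_{⟨g₀⟩}^p`** when all the components outside `N` have the Hom
counts of `B_{⟨g₀⟩}` (e.g. are conjugate to it: Frobenius groups `N ⋊ C_p` — "`JS ∼ JX × JY^p`" —, `A₄`:
"`JX × B_V² ∼ B_τ³`"-type relations; perfect field). [cite: KaniRosen1989, Thm. B] [cite: ReyesCarocca2020, Thm. 7]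
[cite: GaronziDias2019, §5 and §6] -/
theorem isIsogenous_primeIndex_of_forall_eq (hp : p.Prime) (hG : Fintype.card G = p * Fintype.card N)
    (hout : ∀ g : G, g ∉ N → g ^ p = 1) (hg₀ : g₀ ∉ N) (hNG : End.of NG = ∑ g, ρ g)
    (hNN : End.of NN = ∑ h : N, ρ h) {Y : AbelianVariety K}
    (heq : ∀ (n : N) (B : AbelianVariety K),
      Module.finrank ℤ (image (End.asHom (∑ k ∈ Finset.range p, ρ ((g₀ * n) ^ k))) ⟶ B) =
        Module.finrank ℤ (Y ⟶ B)) :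
    IsIsogenous (X ⊞ ⨁ fun _ : Fin p ↦ image NG) (image NN ⊞ ⨁ fun _ : Fin p ↦ Y) := by
  classical
  refine isIsogenous_iff_forall_finrank_hom_eq'.2 fun B ↦ ?_
  rw [finrank_hom_biprod, finrank_hom_biproduct_const, finrank_hom_biprod, finrank_hom_biproduct_const,
    Fintype.card_fin]
  exact (finrank_hom_primeIndex_of_forall_eq ρ hp hG hout hg₀ hNG hNN B fun n ↦ heq n B).symm

end PrimeIndexIsogeny

end AbelianVariety

end Literature.AlgebraicGeometry.Motives
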